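import Summits.MatrixMultiplication.MatrixMultiplication.Theorems.SoloInformedSignConsistency

/-!
# Shift signs: Boolean bookkeeping for Theorem 8.21

This work, §8.8 (T13)(b) steps (1)–(3) / paper `C3-m2.md` §4 (gen 107). Setting of `SoloInformedTranslateWorld`
(CohnUmans2013, arXiv:1207.6528, Def. 12; coprime case, every chart). Signs are carried as `Bool`s through
`sgn e t = t` (`e = true`) or `-t` (`e = false`).

* `shift_sign` — the SHIFT RULE with Boolean signs: `Adm f l c`, `Adm (f + sgn e₁ t) (l + sgn e₂ t) c`, `t ≠ 0` and
  `f ∉ [l + t] ∪ [l - t]` give `c ∼ f - l` if `e₁ = e₂` and `c ∼ f + l` if `e₁ ≠ e₂`.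
* `not_signEq_add_and_sub` — for `f, l ≠ 0` the classes `[f + l]`, `[f - l]` are distinct.
* `beq_eq_beq_of_shift` — two columns read at the same non-degenerate good cell have ALIGNED sign products:
  `(ε₁ == ε) = (δ₁ == δ)`.
* `exists_const_of_antiAligned'` — the counting lemma of `SoloInformedSignConsistency` with general bad-set bounds.
References: this work §8.8 (T13); CohnUmans2013 Def. 12.
-/

namespace Summit.MatrixMultiplication.MatrixMultiplication.Theorems.TwistedTPP

namespace FibreLines

variable {G : Type*} [AddCommGroup G]

/-- A Boolean sign acting on `G`: `sgn true t = t`, `sgn false t = -t`. -/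
def sgn (e : Bool) (t : G) : G := if e then t else -t

/-- `sgn true t = t`. -/
@[simp] theorem sgn_true (t : G) : sgn true t = t := rfl
/-- `sgn false t = -t`. -/
@[simp] theorem sgn_false (t : G) : sgn false t = -t := rfl

/-- `sgn e 0 = 0`. -/
theorem sgn_zero (e : Bool) : sgn e (0 : G) = 0 := by cases e <;> simp

/-- `sgn e t ∼ t`. -/
theorem signEq_sgn (e : Bool) (t : G) : SignEq (sgn e t) t := by
  cases e
  · exact Or.inr rfl
  · exact Or.inl rfl

/-- `sgn` of a `Bool` equality test: `sgn (e₁ == e₂) t = sgn e₁ (sgn e₂ t)`. -/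
theorem sgn_beq (e₁ e₂ : Bool) (t : G) : sgn (e₁ == e₂) t = sgn e₁ (sgn e₂ t) := by
  cases e₁ <;> cases e₂ <;> simp

/-- `sgn e` is an involution. -/
theorem sgn_sgn_self (e : Bool) (t : G) : sgn e (sgn e t) = t := by
  cases e <;> simp

/-- `sgn e (-t) = -(sgn e t)`. -/
theorem sgn_neg (e : Bool) (t : G) : sgn e (-t) = -sgn e t := by
  cases e <;> simp

/-- `sgn e` is additive. -/
theorem sgn_add (e : Bool) (s t : G) : sgn e (s + t) = sgn e s + sgn e t := by
  cases e
  · simp only [sgn_false]; abel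
  · simp

/-- `sgn (!e) t = -(sgn e t)`. -/
theorem sgn_not (e : Bool) (t : G) : sgn (!e) t = -sgn e t := by
  cases e <;> simp

/-- **Shift rule with Boolean signs.** [this work, §8.8 (T13)(b)(1)] -/
theorem shift_sign (hG : ∀ x : G, x = -x → x = 0) {f l c t : G} (e₁ e₂ : Bool) (h0 : Adm f l c)
    (h1 : Adm (f + sgn e₁ t) (l + sgn e₂ t) c) (ht : t ≠ 0) (hgood : ¬ (SignEq f (l + t) ∨ SignEq f (l - t))) :
    (e₁ = e₂ → SignEq c (f - l)) ∧ (e₁ ≠ e₂ → SignEq c (f + l)) := by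
  cases e₁ <;> cases e₂
  · -- (false, false): shift by -t on both
    simp only [sgn_false] at h1
    refine ⟨fun _ => ?_, fun h => absurd rfl h⟩
    rcases adm_shift_same hG h0 h1 with h | h | h
    · exact h
    · exfalso; apply hgood; right; right
      have e : f = -(l + -t) + (f + l + -t) := by abel
      rw [e, h, add_zero, ← sub_eq_add_neg]
    · exact absurd (neg_eq_zero.mp h) ht
  · -- (false, true): f - t, l + t : opposite
    simp only [sgn_false, sgn_true] at h1
    refine ⟨fun h => absurd h (by decide), fun _ => ?_⟩
    have h1' : Adm (f + -t) (l - -t) c := by rwa [sub_neg_eq_add]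
    rcases adm_shift_opp hG h0 h1' with h | h | h
    · exact h
    · exfalso; apply hgood; left; left
      have e : f = (l + t) + (f - l + -t) := by abel
      rw [e, h, add_zero]
    · exact absurd (neg_eq_zero.mp h) ht
  · -- (true, false): f + t, l - t : opposite
    simp only [sgn_false, sgn_true] at h1
    refine ⟨fun h => absurd h (by decide), fun _ => ?_⟩
    have h1' : Adm (f + t) (l - t) c := by rwa [sub_eq_add_neg]
    rcases adm_shift_opp hG h0 h1' with h | h | h
    · exact h
    · exfalso; apply hgood; right; left
      have e : f = (l - t) + (f - l + t) := by abel
      rw [e, h, add_zero]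
    · exact absurd h ht
  · -- (true, true): same
    simp only [sgn_true] at h1
    refine ⟨fun _ => ?_, fun h => absurd rfl h⟩
    rcases adm_shift_same hG h0 h1 with h | h | h
    · exact h
    · exfalso; apply hgood; left; right
      have e : f = -(l + t) + (f + l + t) := by abel
      rw [e, h, add_zero]
    · exact absurd h ht

/-- For `f, l ≠ 0` (no 2-torsion) nothing lies in both classes `[f + l]` and `[f - l]`. -/
theorem not_signEq_add_and_sub (hG : ∀ x : G, x = -x → x = 0) {f l c : G} (hf : f ≠ 0) (hl : l ≠ 0) :
    ¬ (SignEq c (f + l) ∧ SignEq c (f - l)) := by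
  rintro ⟨h₁, h₂⟩
  rcases h₁.symm.trans h₂ with h | h
  · apply hl
    have e : l + l = (f + l) - (f - l) := by abel
    exact eq_zero_of_add_self_eq_zero hG (by rw [e, h, sub_self])
  · apply hf
    have e : f + f = (f + l) + (f - l) := by abel
    exact eq_zero_of_add_self_eq_zero hG (by rw [e, h, neg_add_cancel])

/-- **Aligned sign products.** Reading the same non-degenerate good cell from two locked columns (signs `ε₁, δ₁`
with parameter `t₁` and `ε, δ` with parameter `t`) forces `(ε₁ == ε) = (δ₁ == δ)`. [this work, §8.8 (T13)(b)(3)] -/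
theorem beq_eq_beq_of_shift (hG : ∀ x : G, x = -x → x = 0) {f l c t₁ t : G} (hf : f ≠ 0) (hl : l ≠ 0)
    (ε₁ δ₁ ε δ : Bool) (h0 : Adm f l c) (h1 : Adm (f + sgn ε₁ t₁) (l + sgn δ₁ t₁) c)
    (h2 : Adm (f + sgn ε t) (l + sgn δ t) c) (ht₁ : t₁ ≠ 0) (ht : t ≠ 0)
    (hg₁ : ¬ (SignEq f (l + t₁) ∨ SignEq f (l - t₁))) (hg : ¬ (SignEq f (l + t) ∨ SignEq f (l - t))) :
    (ε₁ == ε) = (δ₁ == δ) := by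
  have A := shift_sign hG ε₁ δ₁ h0 h1 ht₁ hg₁
  have B := shift_sign hG ε δ h0 h2 ht hg
  have X := not_signEq_add_and_sub hG (c := c) hf hl
  by_cases h₁ : ε₁ = δ₁ <;> by_cases h₂ : ε = δ
  · subst h₁; subst h₂; cases ε₁ <;> cases ε <;> rfl
  · exact absurd ⟨B.2 h₂, A.1 h₁⟩ X
  · exact absurd ⟨A.2 h₁, B.1 h₂⟩ X
  · revert h₁ h₂; cases ε₁ <;> cases δ₁ <;> cases ε <;> cases δ <;> simp

/-- **Sign consistency, general bad-set bounds.** As `exists_const_of_antiAligned` with `≤ b₁` bad rows per column and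
`≤ b₂` bad columns per row; needs `2μ + 2b₁ < n` and `μ + b₂ < n`. [this work, §8.8 (T13)(b)(3)] -/
theorem exists_const_of_antiAligned' {ι : Type*} [Fintype ι] [DecidableEq ι] (μ b₁ b₂ : ℕ)
    (hn₁ : 2 * μ + 2 * b₁ < Fintype.card ι) (hn₂ : μ + b₂ < Fintype.card ι)
    (Ideg Kdeg : Finset ι) (hI : Ideg.card ≤ μ) (hK : Kdeg.card ≤ μ)
    (Bad : ι → ι → Prop) [∀ i k, Decidable (Bad i k)]
    (hcol : ∀ k, k ∉ Kdeg → ((Finset.univ \ Ideg).filter (fun i => Bad i k)).card ≤ b₁)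
    (hrow : ∀ i, i ∉ Ideg → ((Finset.univ \ Kdeg).filter (fun k => Bad i k)).card ≤ b₂)
    (ε δ : ι → Bool) (h : ∀ i, i ∉ Ideg → ∀ k, k ∉ Kdeg → ¬ Bad i k → ε i ≠ δ k) :
    ∃ e : Bool, (∀ i, i ∉ Ideg → ε i = e) ∧ (∀ k, k ∉ Kdeg → δ k ≠ e) := by
  have hμ : μ < Fintype.card ι := by omega
  obtain ⟨k₀, hk₀⟩ := exists_notMem_of_card_le Kdeg hK hμ
  let Good : ι → Finset ι := fun k => (Finset.univ \ Ideg).filter (fun i => ¬ Bad i k)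
  have hGood : ∀ k, k ∉ Kdeg → Fintype.card ι ≤ (Good k).card + μ + b₁ := fun k hk =>
    card_good_ge Ideg hI (fun i => Bad i k) (hcol k hk)
  have memGood : ∀ {k i}, i ∈ Good k → i ∉ Ideg ∧ ¬ Bad i k := by
    intro k i hi
    simp only [Good, Finset.mem_filter, Finset.mem_sdiff, Finset.mem_univ, true_and] at hi
    exact hi
  have hδ : ∀ k, k ∉ Kdeg → δ k = δ k₀ := by
    intro k hk
    have hlt : Fintype.card ι < (Good k).card + (Good k₀).card := by
      have := hGood k hk; have := hGood k₀ hk₀; omega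
    obtain ⟨i, hi, hi₀⟩ := exists_mem_inter_of_card (Good k) (Good k₀) hlt
    obtain ⟨hiI, hib⟩ := memGood hi
    obtain ⟨-, hib₀⟩ := memGood hi₀
    exact Bool.eq_of_ne_of_ne (h i hiI k hk hib).symm (h i hiI k₀ hk₀ hib₀).symm
  refine ⟨!(δ k₀), ?_, ?_⟩
  · intro i hi
    have hc := card_good_ge Kdeg hK (fun k => Bad i k) (hrow i hi)
    have hpos : 0 < ((Finset.univ \ Kdeg).filter (fun k => ¬ Bad i k)).card := by omega
    obtain ⟨k, hk⟩ := Finset.card_pos.mp hpos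
    simp only [Finset.mem_filter, Finset.mem_sdiff, Finset.mem_univ, true_and] at hk
    have hne := h i hi k hk.1 hk.2
    rw [hδ k hk.1] at hne
    revert hne; cases ε i <;> cases δ k₀ <;> simp
  · intro k hk
    rw [hδ k hk]
    cases δ k₀ <;> simp

end FibreLines

end Summit.MatrixMultiplication.MatrixMultiplication.Theorems.TwistedTPP
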